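import Summits.Parity.GeneralizedHardyLittlewood.Theorems.LeeYangFibresPrimeCellsRelativeChowlaDefs
import Summits.Parity.GeneralizedHardyLittlewood.Theorems.LeeYangFibresPrimeCellsRelativeHardyLittlewoodDictionary
import Summits.Parity.GeneralizedHardyLittlewood.Theorems.LeeYangFibresAbsoluteUpgradeSinglesDecayThresholds
import Literature.NumberTheory.Sieve.ParityWave0LogChowlaProofs
import HarnessLib

/-!
# Route `LeeYangFibres`, crux `PrimeCellsRelative` (stmt-Parity-14112), line `SketchIdeator4`
# (card `sieve-out-to-chowla`): hardness certificate of the promoted parity input —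
# `LiouvilleTupleMeanPos` implies Chowla's conjecture

The line `SketchIdeator4` reaches the crux from the route's `CellParityLaw` (item stmt-Parity-14109) and ONE new
conjecture-grade input, `LiouvilleTupleMeanPos t` (`t ≥ 2`; vocabulary file
`Theorems/LeeYangFibresPrimeCellsRelativeChowlaDefs.lean`): a Bombieri–Vinogradov mean value for `k`-point Liouville
correlations (`2 ≤ k ≤ t`) along the sub-systems of a non-degenerate one-dimensional system, on integer intervals where
every form is `≥ 1`, with saving `(log N)^{-A}` for every `A`, level `N^η`, worst residue class per modulus
(line theorem `primeCellsRelative_of_cellParityLaw_of_liouvilleTupleMeanPos`, p119571).  The line lead promoted that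
input to the planners as a candidate route item ("crux 2′").  This file certifies, kernel-checked, that the promotion
is honest — the input is at least as strong as a REGISTERED open conjecture of the tree:

* `liouvilleCorrelation_isLittleO_of_liouvilleTupleMeanPos` — for `k ≥ 2`, `LiouvilleTupleMeanPos k` implies the
  `k`-point case of Chowla's conjecture in natural density, `∑_{n < x} λ(n + h₁) ⋯ λ(n + h_k) = o(x)` for pairwise
  distinct shifts (already the modulus `d = 1`, the translate system `(n + hⱼ)ⱼ`, the interval `[1, x − 1]` and `A = 1`
  give `|∑| ≤ 1 + C x / log x`);
* `chowlaConjecture_of_liouvilleTupleMeanPos` — hence **`(∀ t ≥ 2, LiouvilleTupleMeanPos t) → ChowlaConjecture`**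
  (parity.S06, `Literature.NumberTheory.Sieve.ChowlaConjecture`, open for every `k ≥ 2`; the case `k = 1` is the prime
  number theorem, `oddOrderChowla_one`).

So the registered stub `stub_liouvilleTupleMeanPos : ∀ t ≥ 2, LiouvilleTupleMeanPos t` of the skeleton
`Cruxes/PrimeCellsRelative/Lines/SketchIdeator4.lean` is conjecture-grade by a THEOREM, exactly as the residual stub of
the dead line `Sketch` was certified crux-sized by `PrimeCellsRelative → TwinPrimeConjecture` (p89136).  (The converse
direction is not claimed: `LiouvilleTupleMeanPos` asks for progression-uniformity to level `N^η` and log-power savings,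
far beyond `o(x)`.)  Nothing here is asserted about the truth of either statement.

References: Chowla 1965 [Chowla1965] (the conjecture); Tao 2016 [TaoFMP2016] and Tao–Teräväinen 2019
[TaoTeravainen2019AlmostAllScales] (what is known: logarithmic / almost-all-scales averages only).
-/

noncomputable section

open scoped BigOperators Classical
open Finset Filter Asymptotics

namespace Summit.Parity.GeneralizedHardyLittlewood.Cruxes.PrimeCellsRelative.SieveOutToChowla

open Literature.NumberTheory.Sieve
open Summit.Parity.GeneralizedHardyLittlewood.Theorems.AbsoluteUpgrade (eventually_log_ge)
open Summit.Parity.GeneralizedHardyLittlewood.Cruxes.PrimeCellsRelative.Sketch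
  (shift_eval isNondegenerateSystem_shift affLinSize_shift_le)

/-! ## The translate system `(n + hⱼ)ⱼ` with natural shifts (the Dictionary's shift system at `hⱼ ∈ ℕ`; no new definition) -/

/-- `ψⱼ(m) = m + hⱼ`. [folklore] -/
theorem shiftSystem_eval {k : ℕ} (h : Fin k → ℕ) (j : Fin k) (m : ℤ) :
    ((fun j => (⟨fun _ => (1 : ℤ), ((h j : ℕ) : ℤ)⟩ : AffLinForm 1)) j).eval (fun _ => m) = m + h j :=
  shift_eval (fun j => ((h j : ℕ) : ℤ)) j (fun _ => m)

/-- The translate system of pairwise distinct natural shifts is non-degenerate. [cite: GreenTao2010, Def. 1.1] -/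
theorem isNondegenerateSystem_shiftSystem {k : ℕ} (h : Fin k → ℕ) (hinj : Function.Injective h) :
    IsNondegenerateSystem (fun j => (⟨fun _ => (1 : ℤ), ((h j : ℕ) : ℤ)⟩ : AffLinForm 1)) :=
  isNondegenerateSystem_shift (fun j => ((h j : ℕ) : ℤ)) (Nat.cast_injective.comp hinj)

/-- `‖Ψ‖_N ≤ k + k T` for the translate system, `T = max hⱼ`, `N ≥ 1`. [cite: GreenTao2010, (1.1)] -/
theorem affLinSize_shiftSystem_le {k : ℕ} (h : Fin k → ℕ) {N : ℕ} (hN : 1 ≤ N) :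
    affLinSize (fun j => (⟨fun _ => (1 : ℤ), ((h j : ℕ) : ℤ)⟩ : AffLinForm 1)) N ≤ ((k + k * Finset.univ.sup h : ℕ) : ℝ) :=
  affLinSize_shift_le (fun j => ((h j : ℕ) : ℤ)) (T := Finset.univ.sup h)
    (fun j => by rw [Int.natAbs_natCast]; exact Finset.le_sup (Finset.mem_univ j)) hN

/-- On `m ≥ 1` the full tuple sign of the translate system is the genuine Liouville correlation
`∏ⱼ λ(m + hⱼ)`. [folklore] -/
theorem tupleSign_shiftSystem_univ {k : ℕ} (h : Fin k → ℕ) (n : ℕ) :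
    tupleSign (fun j => (⟨fun _ => (1 : ℤ), ((h j : ℕ) : ℤ)⟩ : AffLinForm 1)) Finset.univ ((n : ℤ) + 1) =
      ((∏ j, ArithmeticFunction.liouville (n + 1 + h j) : ℤ) : ℝ) := by
  unfold tupleSign
  rw [Int.cast_prod]
  refine Finset.prod_congr rfl fun j _ => ?_
  rw [shiftSystem_eval, ArithmeticFunction.liouville_apply (by omega : n + 1 + h j ≠ 0)]
  have : ((n : ℤ) + 1 + (h j : ℕ)).toNat = n + 1 + h j := by omega
  rw [this]
  simp

/-- Re-indexing an integer interval `[1, y]` by `range y`. [folklore] -/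
theorem sum_range_eq_sum_Icc_one (f : ℤ → ℝ) (y : ℕ) :
    ∑ n ∈ Finset.range y, f ((n : ℤ) + 1) = ∑ m ∈ Finset.Icc (1 : ℤ) y, f m := by
  refine Finset.sum_nbij' (fun n : ℕ => (n : ℤ) + 1) (fun m : ℤ => (m - 1).toNat) ?_ ?_ ?_ ?_ ?_
  · intro n hn
    rw [Finset.mem_range] at hn
    rw [Finset.mem_Icc]; omega
  · intro m hm
    rw [Finset.mem_Icc] at hm
    rw [Finset.mem_range]; omega
  · intro n _; simp
  · intro m hm
    rw [Finset.mem_Icc] at hm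
    omega
  · intro n _; rfl

/-- The class sum of the translate system on `[1, y]` to the modulus `d = 1` is the Liouville correlation
`∑_{n < y} ∏ⱼ λ(n + 1 + hⱼ)`. [folklore] -/
theorem classSum_shiftSystem_one {k : ℕ} (h : Fin k → ℕ) (y : ℕ) :
    classSum (fun j => (⟨fun _ => (1 : ℤ), ((h j : ℕ) : ℤ)⟩ : AffLinForm 1)) Finset.univ 1 y 1 0 =
      ((∑ n ∈ Finset.range y, ∏ j, ArithmeticFunction.liouville (n + 1 + h j) : ℤ) : ℝ) := by
  unfold classSum
  have hfilter : (Finset.Icc (1 : ℤ) y).filter (fun m : ℤ => m ≡ 0 [ZMOD ((1 : ℕ) : ℤ)]) = Finset.Icc (1 : ℤ) y :=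
    Finset.filter_true_of_mem fun m _ => by simp [Int.ModEq]
  rw [hfilter, Int.cast_sum, ← sum_range_eq_sum_Icc_one]
  exact Finset.sum_congr rfl fun n _ => tupleSign_shiftSystem_univ h n

/-- `∑_{n < x} ∏ⱼ λ(n + hⱼ)` is the `d = 1` class sum on `[1, x − 1]` up to the single term `n = 0` (`|·| ≤ 1`).
[folklore] -/
theorem abs_liouvilleCorrelation_le_one_add {k : ℕ} (h : Fin k → ℕ) (x : ℕ) :
    |(liouvilleCorrelation h x : ℝ)| ≤ 1 + |classSum (fun j => (⟨fun _ => (1 : ℤ), ((h j : ℕ) : ℤ)⟩ : AffLinForm 1)) Finset.univ 1 ((x - 1 : ℕ) : ℤ) 1 0| := by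
  rcases Nat.eq_zero_or_pos x with rfl | _
  · have h0 : 0 ≤ |classSum (fun j => (⟨fun _ => (1 : ℤ), ((h j : ℕ) : ℤ)⟩ : AffLinForm 1)) Finset.univ 1 ((0 - 1 : ℕ) : ℤ) 1 0| := abs_nonneg _
    simp only [liouvilleCorrelation, Finset.range_zero, Finset.sum_empty, Int.cast_zero, abs_zero]
    linarith
  · obtain ⟨y, rfl⟩ : ∃ y, x = y + 1 := ⟨x - 1, by omega⟩
    have hB : |((∏ j, ArithmeticFunction.liouville (0 + h j) : ℤ) : ℝ)| ≤ 1 := by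
      rw [Int.cast_prod]
      exact LogChowla.abs_prod_liouville_le_one _ _
    rw [show y + 1 - 1 = y from rfl, classSum_shiftSystem_one, liouvilleCorrelation, Finset.sum_range_succ',
      Int.cast_add]
    exact (abs_add_le _ _).trans (by linarith [hB])

/-! ## The certificate -/

/-- **`LiouvilleTupleMeanPos k` (`k ≥ 2`) implies `k`-point Chowla in natural density.** For pairwise distinct
shifts `h`, `∑_{n < x} λ(n + h₁) ⋯ λ(n + h_k) = o(x)`: apply the hypothesis with `L = k + k·max hⱼ`, `A = 1` to the
translate system `(n + hⱼ)ⱼ` (non-degenerate, of size `≤ L` at every scale `N ≥ 1`) on the positive interval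
`[1, x − 1] ⊆ [−x, x]`, `S = [k]`, residues `r ≡ 0`, keep the squarefree modulus `d = 1` alone, and add the term `n = 0`:
`|∑| ≤ 1 + C x/log x`. [folklore] -/
theorem liouvilleCorrelation_isLittleO_of_liouvilleTupleMeanPos : ∀ {k : ℕ}, 2 ≤ k → LiouvilleTupleMeanPos k → ∀ h : Fin k → ℕ, Function.Injective h → (fun x : ℕ => (liouvilleCorrelation h x : ℝ)) =o[Filter.atTop] fun x => (x : ℝ) := by
  intro k hk hL h hinj
  obtain ⟨η, hη, C, N₀, hN⟩ := hL (k + k * Finset.univ.sup h) 1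
  rw [Asymptotics.isLittleO_iff]
  intro c hc
  filter_upwards [eventually_ge_atTop N₀, eventually_ge_atTop 2, eventually_log_ge (2 * (|C| + 1) / c),
    eventually_ge_atTop ⌈2 / c⌉₊] with x hx0 hx2 hlog hxc
  have hxr : (2 : ℝ) ≤ x := by exact_mod_cast hx2
  have hxpos : (0 : ℝ) < x := by linarith
  have hlogpos : 0 < Real.log x := Real.log_pos (by linarith)
  -- the hypothesis at scale `x`, interval `[1, x - 1]`, all of `[k]`, residues `0`
  have hI : Finset.Icc (1 : ℤ) ((x - 1 : ℕ) : ℤ) ⊆ Finset.Icc (-(x : ℤ)) x :=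
    Finset.Icc_subset_Icc (by omega) (by omega)
  have hpos : ∀ m ∈ Finset.Icc (1 : ℤ) ((x - 1 : ℕ) : ℤ), ∀ j,
      1 ≤ ((fun j => (⟨fun _ => (1 : ℤ), ((h j : ℕ) : ℤ)⟩ : AffLinForm 1)) j).eval (fun _ => m) := by
    intro m hm j
    rw [shiftSystem_eval]
    have := (Finset.mem_Icc.mp hm).1
    have h0 : (0 : ℤ) ≤ (h j : ℕ) := by positivity
    omega
  have hS : 2 ≤ (Finset.univ : Finset (Fin k)).card := by simpa using hk
  have hb := hN x hx0 (fun j => (⟨fun _ => (1 : ℤ), ((h j : ℕ) : ℤ)⟩ : AffLinForm 1))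
    (isNondegenerateSystem_shiftSystem h hinj) (affLinSize_shiftSystem_le h (by omega)) 1 ((x - 1 : ℕ) : ℤ) hI hpos
    Finset.univ hS (fun _ => 0)
  -- the `d = 1` term alone
  have h1mem : 1 ∈ (Finset.Icc 1 ⌊(x : ℝ) ^ η⌋₊).filter Squarefree := by
    rw [Finset.mem_filter, Finset.mem_Icc]
    exact ⟨⟨le_rfl, Nat.le_floor (by rw [Nat.cast_one]; exact Real.one_le_rpow (by linarith) hη.le)⟩,
      squarefree_one⟩
  have hterm : |classSum (fun j => (⟨fun _ => (1 : ℤ), ((h j : ℕ) : ℤ)⟩ : AffLinForm 1)) Finset.univ 1 ((x - 1 : ℕ) : ℤ) 1 0| ≤ C * x / Real.log x ^ (1 : ℝ) := by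
    refine le_trans ?_ hb
    exact Finset.single_le_sum
      (f := fun d => |classSum (fun j => (⟨fun _ => (1 : ℤ), ((h j : ℕ) : ℤ)⟩ : AffLinForm 1)) Finset.univ 1 ((x - 1 : ℕ) : ℤ) d ((fun _ : ℕ => (0 : ℤ)) d)|)
      (fun d _ => abs_nonneg _) h1mem
  rw [Real.rpow_one] at hterm
  -- `C x / log x ≤ (c/2) x` and `1 ≤ (c/2) x`
  have hCx : C * x / Real.log x ≤ c / 2 * x := by
    rw [div_le_iff₀ hlogpos]
    have h1 : C * x ≤ (|C| + 1) * x := by nlinarith [le_abs_self C]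
    have h2 : (|C| + 1) * x ≤ c / 2 * x * Real.log x := by
      have : 2 * (|C| + 1) / c ≤ Real.log x := hlog
      rw [div_le_iff₀ hc] at this
      nlinarith
    linarith
  have h1x : (1 : ℝ) ≤ c / 2 * x := by
    have : (⌈2 / c⌉₊ : ℝ) ≤ x := by exact_mod_cast hxc
    have h2c : 2 / c ≤ x := (Nat.le_ceil _).trans this
    rw [div_le_iff₀ hc] at h2c
    linarith
  have hmain := abs_liouvilleCorrelation_le_one_add h x
  rw [Real.norm_eq_abs, Real.norm_eq_abs, abs_of_pos hxpos]
  linarith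

/-- **Hardness certificate of the promoted stub: `(∀ t ≥ 2, LiouvilleTupleMeanPos t) → ChowlaConjecture`.**
The line's one new conjecture-grade input implies Chowla's conjecture (parity.S06, Liouville form, natural density,
every `k ≥ 1` and all pairwise distinct shifts): `k ≥ 2` by `liouvilleCorrelation_isLittleO_of_liouvilleTupleMeanPos`,
`k = 1` being the prime number theorem (`oddOrderChowla_one`).  Registered sub-goal of stmt-Parity-14112 (line
`SketchIdeator4`): it certifies that `stub_liouvilleTupleMeanPos` is conjecture-grade, hence correctly promoted rather
than attacked. [folklore] -/
theorem chowlaConjecture_of_liouvilleTupleMeanPos : (∀ t : ℕ, 2 ≤ t → LiouvilleTupleMeanPos t) → ChowlaConjecture := by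
  intro hL k h hk hinj
  rcases Nat.lt_or_ge k 2 with hk2 | hk2
  · obtain rfl : k = 1 := by omega
    exact oddOrderChowla_one h
  · exact liouvilleCorrelation_isLittleO_of_liouvilleTupleMeanPos hk2 (hL k hk2) h hinj

/-- **Corollary: the two hypotheses of the line theorem together imply Chowla's conjecture** (trivially, through the
second one) — recorded so that the conditional `primeCellsRelative_of_cellParityLaw_of_liouvilleTupleMeanPos` is read
with its price tag. [folklore] -/
theorem chowlaConjecture_of_lineHypotheses
    (_hLaw : Summit.Parity.GeneralizedHardyLittlewood.Theses.LeeYangFibres.CellParityLaw)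
    (hL : ∀ t : ℕ, 2 ≤ t → LiouvilleTupleMeanPos t) : ChowlaConjecture :=
  chowlaConjecture_of_liouvilleTupleMeanPos hL

end Summit.Parity.GeneralizedHardyLittlewood.Cruxes.PrimeCellsRelative.SieveOutToChowla

end
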